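import Summits.CriticalPhenomena.SAWScalingLimit.Theorems.SAWDefectDecoherenceBoundaryClosureRPolygonLocalKappa
import Summits.CriticalPhenomena.SAWScalingLimit.Theorems.SAWDefectDecoherenceBoundaryClosureRPolygonLocalK2i
import Summits.CriticalPhenomena.SAWScalingLimit.Theorems.SAWDefectDecoherenceBoundaryClosureRPolygonLocalStretch
import Summits.CriticalPhenomena.SAWScalingLimit.Theorems.SAWDefectDecoherenceBoundaryClosureRPolygonLocalCorner
import HarnessLib

/-!
# The boundary phase function and the local continuum identity on exact polygons
(registered stub `polygonLocalIdentity`, piece C2 of the (A) assembly of `stub_polygonIdentification`;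
crux `BoundaryClosureR`, stmt-CriticalPhenomena-14004, line `polygon-parity-squeeze`)

From the limit data `(g, μ, η)` of an admissible pinned exact polygon family along a mesh sequence
`ns' → 0⁺` (holomorphic `g`, bulk limit functional `η` off the root, positive boundary measure `μ`) we
produce the BOUNDARY PHASE FUNCTION `κ : ℂ → ℂ` with

* K1  `‖κ z‖ = 1` on `∂P`;
* K2c `κ` is locally constant on flat stretches off the root;
* K2i THE LOCAL CONTINUUM IDENTITY `∫_P g ∂̄φ dA = -√3 · n_k · κ z · ∫ φ dμ` for `φ ∈ C_c^∞(B(z, s/2))` at every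
  flat ball `B(z, s)` of form `k` off the root;
* K3  `κ = 1` on the gate `∂P ∩ B(pt 1, ρ)`;
* K4  at an exact corner the values on the two rays differ by `exp(-i(5/8)·arg(n_{k'}/n_k))`.

Assembly of the registered helpers: `exists_boundaryPhase` (lattice phases `Θ_n(z)` and their limit `κ`
along a non-principal ultrafilter, unimodularity, phase property on flat balls), `kappa_const_on_flatBall`
(K2c) and `kappa_gate_eq_one` (K3), `localIdentity_of_phases` (K2i: Green pairing, side limit, no singular
part), `kappa_corner` (K4: threshold pinning and `sidePhase_corner`).
References: Duminil-Copin–Smirnov 2012 §3 and Conjecture 2.  No definition is introduced.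
-/

noncomputable section

open scoped Topology ContDiff
open Filter Set Metric
open Literature.Probability.LatticeModels Literature.Probability.RandomPlanarGeometry
open Literature.Probability.RandomPlanarGeometry.SAW
open Summit.CriticalPhenomena.SAWScalingLimit.Theses.SAWDefectDecoherence
open Summit.CriticalPhenomena.SAWScalingLimit.Theorems.PickHalfPlane
open Summit.CriticalPhenomena.SAWScalingLimit.Theorems.PolygonParitySqueeze.PolygonLocal

namespace Summit.CriticalPhenomena.SAWScalingLimit.Theorems.PolygonParitySqueeze

/-- **REGISTERED STUB `polygonLocalIdentity`** (C2 of the (A) assembly of `stub_polygonIdentification`,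
line `polygon-parity-squeeze`, crux stmt-CriticalPhenomena-14004): the boundary phase function `κ` of the
limit data with K1 (unit), K2c (locally constant on flat stretches), K2i (the local continuum identity
`∫_P g ∂̄φ = -√3 n_k κ ∫ φ dμ`), K3 (`= 1` on the gate), K4 (corner jumps `exp(-i(5/8)T)`).
[cite: DuminilCopinSmirnov2012, §3 and Conjecture 2] -/
theorem polygonLocalIdentity : ∀ (D : DobrushinDomain) (ρ : ℝ) (Λ : ℝ → Finset HexVertex) (m : ℝ → ℤ) (b : ℝ → Sym2 HexVertex), AdmissibleFamily D ρ Λ m b → ExactPolygonFamily D Λ → ∀ (a : ℝ → Sym2 HexVertex) (r₀ : ℝ) (m₀ : ℝ → ℤ), PinnedFlatRoot D Λ b (D.pt 0) a r₀ m₀ → 2 * ρ < dist (D.pt 0) (D.pt 1) → (∀ K : Set ℂ, IsCompact K → K ⊆ closure D.carrier → D.pt 0 ∉ K → L1BoundOn Λ a b K) → RootTightAt Λ a b (D.pt 0) → (∀ z ∈ frontier D.carrier, z ≠ D.pt 0 → BoundaryLayerBudgetAt Λ a b z) → DefectDecoherence → MassRatio → ∀ (ns' : ℕ → ℝ) (g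 : ℂ → ℂ) (μ : MeasureTheory.Measure ℂ) (η : (ℂ → ℂ) → ℂ), Filter.Tendsto ns' Filter.atTop (𝓝[>] 0) → DifferentiableOn ℂ g D.carrier → (∀ ψ : ℂ → ℂ, Continuous ψ → HasCompactSupport ψ → D.pt 0 ∉ tsupport ψ → Filter.Tendsto (fun n => NF Λ a b (ns' n) ψ) Filter.atTop (𝓝 (η ψ))) → (∀ ψ : ℂ → ℂ, Continuous ψ → HasCompactSupport ψ → tsupport ψ ⊆ D.carrier → η ψ = ∫ z, ψ z * g z) → (∀ K : Set ℂ, IsCompact K → D.pt 0 ∉ K → ∃ C : ℝ, ∀ ψ : ℂ → ℂ, Continuous ψ → tsupport ψ ⊆ K → ∀ M : ℝ, (∀ z, ‖ψ z‖ ≤ M) → ‖η ψ‖ ≤ C * M) → (∀ K : Set ℂ, IsCompact K → D.pt 0 ∉ K → MeasureTheory.IntegrableOn g (K ∩ D.carrier)) → (∀ ε : ℝ, 0 < ε → ∃ r : ℝ, 0 < r ∧ ∫ z in Metric.ball (D.pt 0) r ∩ D.carrier, ‖g z‖ ≤ ε) → (∀ K : Set ℂ, IsCompact K → D.pt 0 ∉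 K → μ K < ⊤) → μ (frontier D.carrier)ᶜ = 0 → (∀ w : ℂ → ℝ, Continuous w → HasCompactSupport w → D.pt 0 ∉ tsupport w → Filter.Tendsto (fun n => (ns' n) * ∑ᶠ e ∈ hexDomainBoundary (Λ (ns' n)), w (((ns' n : ℝ) : ℂ) * hexMidpoint e) * (‖hexParafermionicObservable (Λ (ns' n)) (a (ns' n)) hexCriticalFugacity 0 e‖ / ‖hexParafermionicObservable (Λ (ns' n)) (a (ns' n)) hexCriticalFugacity 0 (b (ns' n))‖)) Filter.atTop (𝓝 (∫ z, w z ∂μ))) → ∃ κ : ℂ → ℂ, (∀ z ∈ frontier D.carrier, ‖κ z‖ = 1) ∧ (∀ z ∈ frontier D.carrier, z ≠ D.pt 0 → ∀ (k : Fin 6) (s : ℝ), 0 < s → D.carrier ∩ Metric.ball z s = halfPlane k z ∩ Metric.ball z s → (∀ᶠ δ : ℝ in 𝓝[>] 0, ∃ nthr : ℤ, ∀ v : HexVertex, (δ : ℂ) * hexCenter v ∈ Metric.ball z s → (v ∈ Λ δ ↔ nthr ≤ zigzagForm k v)) → D.pt 0 ∉ Metric.closedBall z s → ∀ z' ∈ frontier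 D.carrier ∩ Metric.ball z s, κ z' = κ z) ∧ (∀ z ∈ frontier D.carrier, z ≠ D.pt 0 → ∀ (k : Fin 6) (s : ℝ), 0 < s → D.carrier ∩ Metric.ball z s = halfPlane k z ∩ Metric.ball z s → (∀ᶠ δ : ℝ in 𝓝[>] 0, ∃ nthr : ℤ, ∀ v : HexVertex, (δ : ℂ) * hexCenter v ∈ Metric.ball z s → (v ∈ Λ δ ↔ nthr ≤ zigzagForm k v)) → D.pt 0 ∉ Metric.closedBall z s → ∀ φ : ℂ → ℂ, ContDiff ℝ ∞ φ → HasCompactSupport φ → tsupport φ ⊆ Metric.ball z (s / 2) → ∫ w in D.carrier, g w * Literature.Analysis.Complex.dbarAlong 1 φ w = -(Real.sqrt 3 : ℂ) * innerNormal k * κ z * ∫ w, φ w ∂μ) ∧ (∀ z ∈ frontier D.carrier ∩ Metric.ball (D.pt 1) ρ, κ z = 1) ∧ (∀ z ∈ frontier D.carrier, ∀ (k k' : Fin 6) (s : ℝ), 0 < s → innerNormal k' ≠ innerNormal k → innerNormal k' ≠ -innerNormal k → (D.carrier ∩ Metric.ball z s = halfPlane k z ∩ halfPlane k' z ∩ Metric.ball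 z s ∨ D.carrier ∩ Metric.ball z s = (halfPlane k z ∪ halfPlane k' z) ∩ Metric.ball z s) → (∀ᶠ δ : ℝ in 𝓝[>] 0, ∃ nk nk' : ℤ, (∀ v : HexVertex, (δ : ℂ) * hexCenter v ∈ Metric.ball z s → (v ∈ Λ δ ↔ (nk ≤ zigzagForm k v ∧ nk' ≤ zigzagForm k' v))) ∨ (∀ v : HexVertex, (δ : ℂ) * hexCenter v ∈ Metric.ball z s → (v ∈ Λ δ ↔ (nk ≤ zigzagForm k v ∨ nk' ≤ zigzagForm k' v)))) → D.pt 0 ∉ Metric.closedBall z s → ∀ z₁ ∈ frontier D.carrier ∩ Metric.ball z s, ∀ z₂ ∈ frontier D.carrier ∩ Metric.ball z s, z₁ ≠ z → ((z₁ - z) * (starRingEnd ℂ) (innerNormal k)).re = 0 → z₂ ≠ z → ((z₂ - z) * (starRingEnd ℂ) (innerNormal k')).re = 0 → κ z₂ = Complex.exp (-(5 / 8 : ℂ) * (Complex.arg (innerNormal k' / innerNormal k) : ℂ) * Complex.I) * κ z₁) := by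
  intro D ρ Λ m b hAF _hEP a r₀ m₀ hPR hdist _hL1b _hRT hBL hDD hMR ns' g μ η hns hg hbulk hin hbd hL1 _hroot hmf hms hside
  obtain ⟨U, Θ, κ, hUle, hUne, hκT, hκ1, hΘ2⟩ := exists_boundaryPhase D ρ Λ m b hAF a r₀ m₀ hPR ns' hns
  haveI := hUne
  refine ⟨κ, fun z _ => hκ1 z, ?_, ?_, ?_, ?_⟩
  · -- K2c: locally constant on flat stretches
    intro z _ _ k s hs hset hex hroot z' hz'
    exact kappa_const_on_flatBall D ρ Λ m b hAF a r₀ m₀ hPR ns' hns U Θ κ hUle hUne hκT hΘ2 z k s hs hset hex hroot z' hz'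
  · -- K2i: the local continuum identity
    intro z _ _ k s hs hset hex hroot φ hφ hφc hφs
    exact localIdentity_of_phases D ρ Λ m b hAF a r₀ m₀ hPR hBL hDD hMR ns' g μ η U hns hUle hUne hg hbulk hin hbd hL1
      hmf hms hside z k s hs hset hex hroot (fun n => Θ n z) (κ z) (hκT z) (hΘ2 z k s hs hex hroot) φ hφ hφc hφs
  · -- K3: gate normalisation
    exact kappa_gate_eq_one hAF hPR hdist hns hUle hκT hΘ2
  · -- K4: corner jumps
    intro z _ k k' s hs hne hne' hsetC hexC hrootC z₁ hz₁ z₂ hz₂ h1 h2 h3 h4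
    exact kappa_corner D ρ Λ m b hAF a r₀ m₀ hPR ns' hns U Θ κ hUle hUne hκT hΘ2 z k k' s hs hne hne' hsetC hexC hrootC
      z₁ hz₁ z₂ hz₂ h1 h2 h3 h4

end Summit.CriticalPhenomena.SAWScalingLimit.Theorems.PolygonParitySqueeze

end
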